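import Summits.ValiantsHypothesis.ValiantsHypothesis.Theorems.BorderApolarityFixedWitnessObstructionQPOrderChain
import Literature.Combinatorics.Optimization.EgervaryDuality
import Literature.Computability.AlgebraicComplexity.DeterminantIrreducible

/-!
# Border apolarity, crux `FixedWitnessObstructionQP` — calibration: torus degenerations of `det_m` itself are TIGHT

Route `ValiantsHypothesis/BorderApolarity`, crux item `stmt-ValiantsHypothesis-5778`, line `toric-face-debordering`
(lead seat -2).  The line's open residue is a quasi-polynomial MUROTA GAP for extremal toric representations
`pp = u · in_w(g · det_m)` (`PotentialGapQP`, `…QPOrderChain.lean`).  Calibration at `g = 1`: for EVERY weight `w` on the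
`m²` entries, Egerváry's optimal potentials of the weight matrix are feasible and tight for the generic matrix `x`, so the
gap of the extremal slice `in_w(det_m) = wHC_w^e (det_m)` is `0` and the slice is an honest `m × m` determinant of linear
forms (indeed `det` of the equality-subgraph restriction of `x`):

* `exists_tight_potentials_detPoly` — feasible potentials with `Σp + Σq = e` for the extremal level `e` of any `w`;
* `hasDetRepr_weightedHomogeneousComponent_detPoly` — `dc(in_w(det_m)) ≤ m`.

So `PotentialGapQP` (hence `ToricDeborderQP`) holds with gap `0` on the whole torus-orbit closure of `det_m`, exactly as it
holds with 0/1 weights on `End(W) · det_m` (`exists_extremal_zeroOne_of_mem_endOrbit`, `…QPReduction.lean`); every unit of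
gap needs a translate `g` whose coefficient matrices interact (Murota: rank `≥ 2` layers).  Uses the landed Egerváry
duality (`Literature/Combinatorics/Optimization/EgervaryDuality.lean`).
-/

open scoped BigOperators Matrix
open MvPolynomial
open Literature.Computability.AlgebraicComplexity

namespace Summit.ValiantsHypothesis.ValiantsHypothesis.Theorems.BorderApolarityFixedWitnessObstructionQP

set_option linter.dupNamespace false

/-- **The tight coefficient matrix computes the weight-`(Σp+Σq)` slice** (Murota's combinatorial relaxation in one identity).
For a matrix `L` of linear forms, a weight `w` and FEASIBLE potentials `(p, q)` (the weight-`j` layer of `L_ab` vanishes for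
`j > p_a + q_b`), the determinant of the TIGHT LAYER matrix `(wHC_w^{p_a + q_b} (L_ab))_ab` is the weight-`(Σp + Σq)` component of
`det L`.  So the relaxation value `Σp + Σq` is the true top weight of `det L` iff `det` of the tight matrix is nonzero, and then it IS
the top slice. [cite: Murota1995CombinatorialRelaxation, §4] -/
theorem det_tightLayer_eq_weightedHomogeneousComponent {σ : Type} [Fintype σ] [DecidableEq σ] {ι : Type} [Fintype ι]
    [DecidableEq ι] (L : Matrix ι ι (MvPolynomial σ ℂ)) (hL : ∀ a b, (L a b).IsHomogeneous 1) (w : σ → ℕ) (p q : ι → ℕ)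
    (hfeas : ∀ a b j, p a + q b < j → weightedHomogeneousComponent w j (L a b) = 0) :
    (Matrix.of fun a b => weightedHomogeneousComponent w (p a + q b) (L a b)).det =
      weightedHomogeneousComponent w (∑ a, p a + ∑ b, q b) L.det := by
  have hframe := stub_deborderFrame σ ι L hL w (∑ a, p a + ∑ b, q b) p q hfeas le_rfl
  rw [Nat.sub_self] at hframe
  rw [hframe]
  have hM : (Matrix.of fun a b => ∑ i ∈ Finset.range (0 + 1), Polynomial.monomial i
      (if i ≤ p a + q b then weightedHomogeneousComponent w (p a + q b - i) (L a b) else 0)) =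
      (Polynomial.C : MvPolynomial σ ℂ →+* _).mapMatrix
        (Matrix.of fun a b => weightedHomogeneousComponent w (p a + q b) (L a b)) := by
    ext a b
    simp [Polynomial.monomial_zero_left]
  rw [hM, ← RingHom.map_det, Polynomial.coeff_C_zero]

/-- **The dichotomy (tight / fooling).**  If moreover `e` is EXTREMAL for `det L` (`⟨w, d⟩ ≤ e` on its support) then either the
potentials are tight (`Σp + Σq = e`, and the slice `wHC_w^e (det L)` is `det` of the tight layer matrix — an honest determinant of the
same size), or there is a positive gap `Σp + Σq > e` and the tight layer matrix is SINGULAR: its determinant is the weight-`(Σp+Σq)`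
component of `det L`, which vanishes above the extremal level.  (Branches (T)/(F) of crux 4's card `graded-tight-matrix-dichotomy`.)
[cite: Murota1995CombinatorialRelaxation, §4] -/
theorem det_tightLayer_eq_zero_of_gap_pos {σ : Type} [Fintype σ] [DecidableEq σ] {ι : Type} [Fintype ι]
    [DecidableEq ι] (L : Matrix ι ι (MvPolynomial σ ℂ)) (hL : ∀ a b, (L a b).IsHomogeneous 1) (w : σ → ℕ) (e : ℕ)
    (p q : ι → ℕ) (hfeas : ∀ a b j, p a + q b < j → weightedHomogeneousComponent w j (L a b) = 0)
    (hext : ∀ d ∈ L.det.support, Finsupp.weight w d ≤ e) (hgap : e < ∑ a, p a + ∑ b, q b) :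
    (Matrix.of fun a b => weightedHomogeneousComponent w (p a + q b) (L a b)).det = 0 := by
  rw [det_tightLayer_eq_weightedHomogeneousComponent L hL w p q hfeas]
  refine weightedHomogeneousComponent_eq_zero' _ L.det fun d hd hde => ?_
  have := hext d hd
  omega

/-- The `w`-weight of a permutation monomial `x^{μ_ρ}` is `Σ_i w (ρ i, i)`. [folklore] -/
theorem weight_permMonomial {n : Type*} [Fintype n] [DecidableEq n] (w : n × n → ℕ) (ρ : Equiv.Perm n) :
    Finsupp.weight w (permMonomial ρ) = ∑ i, w (ρ i, i) := by
  rw [permMonomial, map_sum]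
  refine Finset.sum_congr rfl fun i _ => ?_
  rw [Finsupp.weight_apply, Finsupp.sum_single_index (by simp)]
  simp

/-- **Egerváry potentials are tight for the generic matrix.**  For every weight `w` on the entries of the generic
`m × m` matrix and every level `e` that is EXTREMAL (`⟨w, d⟩ ≤ e` on the support of `det_m`) and ATTAINED
(`wHC_w^e (det_m) ≠ 0`), there are feasible potentials (`p_a + q_b ≥ w_ab`, i.e. the weight-`j` layer of `x_ab` vanishes
for `j > p_a + q_b`) with gap zero, `Σp + Σq = e`: Egerváry's optimum is the weight of a tight permutation monomial, which
lies in the support (`≤ e`), and the attained level is the weight of some permutation monomial (`≤ Σp + Σq`, weak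
duality). [folklore] -/
theorem exists_tight_potentials_detPoly (m : ℕ) (w : Fin m × Fin m → ℕ) (e : ℕ)
    (hext : ∀ d ∈ (detPoly (Fin m) ℂ).support, Finsupp.weight w d ≤ e)
    (hne : weightedHomogeneousComponent w e (detPoly (Fin m) ℂ) ≠ 0) :
    ∃ p q : Fin m → ℕ,
      (∀ a b j, p a + q b < j → weightedHomogeneousComponent w j (X (a, b) : MvPolynomial (Fin m × Fin m) ℂ) = 0) ∧
      ∑ a, p a + ∑ b, q b = e := by
  obtain ⟨p, q, σ, hfeas, htight⟩ :=
    Literature.Combinatorics.Optimization.EgervaryDuality_holds (Fin m) fun a b => w (a, b)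
  refine ⟨p, q, fun a b j hj => ?_, le_antisymm ?_ ?_⟩
  · rw [weightedHomogeneousComponent_eq_zero']
    intro d hd hde
    rw [MvPolynomial.support_X, Finset.mem_singleton] at hd
    subst hd
    rw [Finsupp.weight_apply, Finsupp.sum_single_index (by simp)] at hde
    simp only [one_smul] at hde
    have := hfeas a b
    omega
  · -- `Σp + Σq` is the weight of the tight permutation monomial, which lies in the support
    have hsum : ∑ a, p a + ∑ b, q b = ∑ a, w (a, σ a) := by
      rw [← Equiv.sum_comp σ q, ← Finset.sum_add_distrib]
      exact Finset.sum_congr rfl fun a _ => htight a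
    have hperm : ∑ a, w (a, σ a) = Finsupp.weight w (permMonomial σ.symm) := by
      rw [weight_permMonomial, ← Equiv.sum_comp σ (fun i => w (σ.symm i, i))]
      simp
    rw [hsum, hperm]
    refine hext _ (mem_support_iff.mpr ?_)
    rw [coeff_permMonomial_detPoly]
    exact intCast_sign_ne_zero ℂ _
  · -- the attained level is the weight of some permutation monomial
    have hex : ¬ ∀ d ∈ (detPoly (Fin m) ℂ).support, Finsupp.weight w d ≠ e := fun h =>
      hne (weightedHomogeneousComponent_eq_zero' e (detPoly (Fin m) ℂ) h)
    push Not at hex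
    obtain ⟨d, hd, hde⟩ := hex
    obtain ⟨ρ, hρ⟩ := exists_permMonomial_eq_of_coeff_detPoly_ne_zero ℂ (mem_support_iff.mp hd)
    rw [← hde, ← hρ, weight_permMonomial]
    calc ∑ i, w (ρ i, i) ≤ ∑ i, (p (ρ i) + q i) := Finset.sum_le_sum fun i _ => hfeas (ρ i) i
      _ = ∑ i, p (ρ i) + ∑ i, q i := Finset.sum_add_distrib
      _ = ∑ a, p a + ∑ b, q b := by rw [Equiv.sum_comp ρ p]

/-- **Torus degenerations of the determinant de-border for free**: for every weight `w` on the entries and its extremal,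
attained level `e`, the initial form `in_w(det_m) = wHC_w^e (det_m)` is an honest `m × m` determinant of linear forms
(the tight layer of the generic matrix at Egerváry's potentials, i.e. `x` restricted to the equality subgraph), so
`dc(in_w(det_m)) ≤ m`: the Murota gap vanishes identically on the torus-orbit closure of `det_m`. [folklore] -/
theorem hasDetRepr_weightedHomogeneousComponent_detPoly (m : ℕ) (w : Fin m × Fin m → ℕ) (e : ℕ)
    (hext : ∀ d ∈ (detPoly (Fin m) ℂ).support, Finsupp.weight w d ≤ e)
    (hne : weightedHomogeneousComponent w e (detPoly (Fin m) ℂ) ≠ 0) :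
    HasDetRepr (weightedHomogeneousComponent w e (detPoly (Fin m) ℂ)) m := by
  obtain ⟨p, q, hfeas, htight⟩ := exists_tight_potentials_detPoly m w e hext hne
  have h := hasDetRepr_slice_of_tight_potentials (1 : Matrix (Fin m × Fin m) (Fin m × Fin m) ℂ) 1 w e p q
    (fun a b j hj => by rw [linSubst_one, AlgHom.id_apply]; exact hfeas a b j hj) htight
  simpa only [linSubst_one, AlgHom.id_apply] using h

/-- Hence `dc(in_w(det_m)) ≤ m` for every torus degeneration of the determinant. [folklore] -/
theorem determinantalComplexity_weightedHomogeneousComponent_detPoly_le (m : ℕ) (w : Fin m × Fin m → ℕ) (e : ℕ)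
    (hext : ∀ d ∈ (detPoly (Fin m) ℂ).support, Finsupp.weight w d ≤ e)
    (hne : weightedHomogeneousComponent w e (detPoly (Fin m) ℂ) ≠ 0) :
    determinantalComplexity (weightedHomogeneousComponent w e (detPoly (Fin m) ℂ)) ≤ m :=
  determinantalComplexity_le_of_hasDetRepr (hasDetRepr_weightedHomogeneousComponent_detPoly m w e hext hne)

/-- **Torus degenerations of `det_m` de-border for free, packaged** (registered stub `stub_tightDet` of crux stmt-5778, line
`toric-face-debordering`; the `g = 1` calibration of `PotentialGapQP`): every extremal, attained initial form `in_w(det_m)` is an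
honest `m × m` determinant of linear forms. [folklore] -/
theorem stub_tightDet : ∀ (m : ℕ) (w : Fin m × Fin m → ℕ) (e : ℕ), (∀ d ∈ (detPoly (Fin m) ℂ).support, Finsupp.weight w d ≤ e) → MvPolynomial.weightedHomogeneousComponent w e (detPoly (Fin m) ℂ) ≠ 0 → HasDetRepr (MvPolynomial.weightedHomogeneousComponent w e (detPoly (Fin m) ℂ)) m :=
  fun m w e hext hne => hasDetRepr_weightedHomogeneousComponent_detPoly m w e hext hne

end Summit.ValiantsHypothesis.ValiantsHypothesis.Theorems.BorderApolarityFixedWitnessObstructionQP
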